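import Literature.AnabelianGeometry.SemiGraphs.TemperedVerticialInjective
import HarnessLib

/-!
# Translation coverings: an object of `B^cov(𝒢)` from characters of the vertex groups into a finite group and
# intertwiners along the branches ([SemiAnbd] §3 p. 36, Def. 3.5 (i))

S. Mochizuki, *Semi-graphs of anabelioids*, Publ. RIMS **42** (2006), §3 p. 36 («a countable discrete continuous
`Π_v`-set `S_v` for every vertex, … `S_e` for every edge, and for every branch … a gluing isomorphism `S_e ≅ b^* S_v`»),
Def. 3.5 (i) p. 37 (these data ARE the coverings `𝒢' → 𝒢`) [cite: MochizukiSemiAnbd2006, Def 3.5(i) p.37].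

PROOF-ONLY file (abc-iut cell, seat abc-iut-L5-d5 gen 10, row «COR23VI-HF-TWO-LEVEL@CAVEAT», part (2c); over
abc-iut-L3-t2's `CovObj` / `BTemp.res` / `BTemp.isoOfEquiv`; no definition, no instance, no notation, no `Prop` fact).
A reusable CONSTRUCTOR of finite coverings in the tree's local presentation `CovObj 𝒢`:

* **`TranslationCover.exists_cover`** — given a finite discrete group `M`, continuous homomorphisms `χ_v : Π_v → M` at
  every vertex and, for every two DISTINCT branches `b ≠ b'` of one edge abutting to `v, v'`, a bijection of `M`
  intertwining the left-translation actions of `Π_e` through `χ_{v'} ∘ b'_*` (transported along `edgeOf b' = edgeOf b`)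
  and `χ_v ∘ b_*`, there is a FINITE `S : CovObj 𝒢` (all fibres `M`; `Π_v` acts through `χ_v`; `Π_e` through
  `χ_{v₀} ∘ b₀_*` for a reference abutting branch, trivially if `e` abuts no vertex) with the two KERNEL DICTIONARIES:
  `γ ∈ Π_v` fixes `S_v` pointwise iff `χ_v(γ) = 1`; for EVERY abutting branch `(b, v)`, `γ ∈ Π_e` fixes `S_e` pointwise
  iff `χ_v(b_* γ) = 1` (an intertwiner matches kernels, `eq_one_iff_of_intertwiner`);
* transport bookkeeping `transport_eq_self`, `forall_transport`, `exists_transport` for `he ▸ (χ_{v'} ∘ b'_*)`.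

Nothing of [SemiAnbd] is asserted; no side taken on [IUTchIII] Cor. 3.12; nothing here asserts that abc is proved or
refuted.
-/

noncomputable section

namespace Literature.IUT.HodgeTheaters

open _root_.Topology CategoryTheory
open scoped Pointwise
open Literature.AnabelianGeometry.SemiGraphs
open Literature.AnabelianGeometry.SemiGraphs.ProfiniteSemiGraph

namespace TranslationCover

variable {𝒢 : ProfiniteSemiGraph.{0}} {M : Type} [Group M] [TopologicalSpace M] [DiscreteTopology M] [Finite M]

omit [DiscreteTopology M] [Finite M] in
/-- Transport of `χ_{v'} ∘ b'_*` along `edgeOf b' = edgeOf b` is the identity when `b' = b`. [cite: MochizukiSemiAnbd2006, Def 3.5(i) p.37] -/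
theorem transport_eq_self (χ : ∀ v : 𝒢.graph.Vertex, 𝒢.Gv v →ₜ* M) {b b' : 𝒢.graph.Branch} {v v' : 𝒢.graph.Vertex}
    (hb : 𝒢.graph.abuts b = some v) (hb' : 𝒢.graph.abuts b' = some v')
    (he : 𝒢.graph.edgeOf b' = 𝒢.graph.edgeOf b) (hbb : b' = b) (t : 𝒢.Ge (𝒢.graph.edgeOf b)) :
    (he ▸ (χ v').comp (𝒢.brHom b' v' hb') : 𝒢.Ge (𝒢.graph.edgeOf b) →ₜ* M) t = χ v (𝒢.brHom b v hb t) := by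
  subst hbb
  obtain rfl : v' = v := Option.some.inj (hb'.symm.trans hb)
  rfl

omit [TopologicalSpace M] [DiscreteTopology M] [Finite M] in
/-- An intertwiner of two translation actions matches their kernels. [cite: MochizukiSemiAnbd2006, Def 3.5(i) p.37] -/
theorem eq_one_iff_of_intertwiner {K : Type*} (ψ ψ' : K → M) (A : M ≃ M)
    (hA : ∀ (t : K) (m : M), A (ψ' t * m) = ψ t * A m) (t : K) : ψ' t = 1 ↔ ψ t = 1 := by
  constructor
  · intro h
    have := hA t 1
    rw [h, one_mul] at this
    exact (mul_eq_right.mp this.symm)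
  · intro h
    have := hA t 1
    rw [h, one_mul] at this
    exact mul_eq_right.mp (A.injective this)

/-- **Translation coverings** ([SemiAnbd] §3 p. 36, Def. 3.5 (i): an object of `B^cov(𝒢)` = sets with continuous actions
of the `Π_v`, `Π_e` glued along the abutting branches).  Given a finite discrete group `M`, continuous homomorphisms
`χ_v : Π_v → M` at every vertex, and, for every two DISTINCT branches `b ≠ b'` of one edge abutting to `v`, `v'`, a
bijection of `M` intertwining the left-translation actions of `Π_e` through `χ_{v'} ∘ b'_*` and `χ_v ∘ b_*`, there is a
FINITE covering `S` of `𝒢` in which: `γ ∈ Π_v` fixes `S_v` pointwise iff `χ_v(γ) = 1`, and for EVERY abutting branch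
`(b, v)`, `γ ∈ Π_e` fixes `S_e` pointwise iff `χ_v(b_* γ) = 1`.  (All fibres are `M`: `Π_v` acts through `χ_v`, `Π_e`
through `χ_{v₀} ∘ b₀_*` for one reference abutting branch of `e` — trivially if `e` abuts no vertex — and the gluings
are the given intertwiners.) [cite: MochizukiSemiAnbd2006, Def 3.5(i) p.37] -/
theorem exists_cover (χ : ∀ v : 𝒢.graph.Vertex, 𝒢.Gv v →ₜ* M)
    (hglue : ∀ (b : 𝒢.graph.Branch) (v : 𝒢.graph.Vertex) (hb : 𝒢.graph.abuts b = some v)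
      (b' : 𝒢.graph.Branch) (v' : 𝒢.graph.Vertex) (hb' : 𝒢.graph.abuts b' = some v')
      (he : 𝒢.graph.edgeOf b' = 𝒢.graph.edgeOf b), b' ≠ b →
      ∃ A : M ≃ M, ∀ (t : 𝒢.Ge (𝒢.graph.edgeOf b)) (m : M),
        A ((he ▸ (χ v').comp (𝒢.brHom b' v' hb') : 𝒢.Ge (𝒢.graph.edgeOf b) →ₜ* M) t * m) =
          χ v (𝒢.brHom b v hb t) * A m) :
    ∃ S : CovObj 𝒢, S.IsFinite ∧
      (∀ (v : 𝒢.graph.Vertex) (γ : 𝒢.Gv v), (∀ s, (S.SV v).obj.ρ γ s = s) ↔ χ v γ = 1) ∧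
      (∀ (b : 𝒢.graph.Branch) (v : 𝒢.graph.Vertex) (hb : 𝒢.graph.abuts b = some v)
        (γ : 𝒢.Ge (𝒢.graph.edgeOf b)),
        (∀ s, (S.SE (𝒢.graph.edgeOf b)).obj.ρ γ s = s) ↔ χ v (𝒢.brHom b v hb γ) = 1) := by
  classical
  -- the master object: `M` acting on itself by left translation
  haveI : Countable M := inferInstance
  let T₀ : BTemp M := ⟨Action.ofMulAction M M, ⟨(inferInstance : Countable M), fun x => isOpen_discrete _⟩⟩
  -- a reference abutting branch of each edge, and the edge characters
  let R : 𝒢.graph.Edge → Type := fun e =>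
    {bv : 𝒢.graph.Branch × 𝒢.graph.Vertex // 𝒢.graph.abuts bv.1 = some bv.2 ∧ 𝒢.graph.edgeOf bv.1 = e}
  let η : ∀ e : 𝒢.graph.Edge, 𝒢.Ge e →ₜ* M := fun e =>
    if h : Nonempty (R e) then
      ((Classical.choice h).2.2 ▸ (χ (Classical.choice h).1.2).comp
        (𝒢.brHom (Classical.choice h).1.1 (Classical.choice h).1.2 (Classical.choice h).2.1))
    else 1
  -- the intertwiners along every abutting branch
  have hA : ∀ (b : 𝒢.graph.Branch) (v : 𝒢.graph.Vertex) (hb : 𝒢.graph.abuts b = some v),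
      ∃ A : M ≃ M, ∀ (t : 𝒢.Ge (𝒢.graph.edgeOf b)) (m : M),
        A (η (𝒢.graph.edgeOf b) t * m) = χ v (𝒢.brHom b v hb t) * A m := by
    intro b v hb
    have hne : Nonempty (R (𝒢.graph.edgeOf b)) := ⟨⟨(b, v), hb, rfl⟩⟩
    set p := Classical.choice hne with hp
    have hη : η (𝒢.graph.edgeOf b) = (p.2.2 ▸ (χ p.1.2).comp (𝒢.brHom p.1.1 p.1.2 p.2.1)) := by
      simp only [η, dif_pos hne]
      rfl
    by_cases hpb : p.1.1 = b
    · refine ⟨Equiv.refl M, fun t m => ?_⟩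
      rw [hη, Equiv.refl_apply, Equiv.refl_apply, transport_eq_self χ hb p.2.1 p.2.2 hpb t]
    · obtain ⟨A, hA⟩ := hglue b v hb p.1.1 p.1.2 p.2.1 p.2.2 hpb
      exact ⟨A, fun t m => by rw [hη]; exact hA t m⟩
  -- the covering
  let S : CovObj 𝒢 :=
    { SV := fun v => (BTemp.res (χ v)).obj T₀
      SE := fun e => (BTemp.res (η e)).obj T₀
      glue := fun b v hb => BTemp.isoOfEquiv (hA b v hb).choose fun t m => (hA b v hb).choose_spec t m }
  haveI hfin : Finite M := inferInstance
  refine ⟨S, ⟨fun _ => hfin, fun _ => hfin⟩, fun v γ => ?_, fun b v hb γ => ?_⟩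
  · change (∀ s : M, χ v γ * s = s) ↔ χ v γ = 1
    exact ⟨fun h => mul_eq_right.mp (h 1), fun h s => by rw [h, one_mul]⟩
  · change (∀ s : M, η (𝒢.graph.edgeOf b) γ * s = s) ↔ χ v (𝒢.brHom b v hb γ) = 1
    rw [← eq_one_iff_of_intertwiner _ _ (hA b v hb).choose (hA b v hb).choose_spec γ]
    exact ⟨fun h => mul_eq_right.mp (h 1), fun h s => by rw [h, one_mul]⟩

omit [DiscreteTopology M] [Finite M] in
/-- Values of a transported homomorphism: every value of `he ▸ f` is a value of `f`. [cite: MochizukiSemiAnbd2006, Def 3.5(i) p.37] -/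
theorem forall_transport (χ : ∀ v : 𝒢.graph.Vertex, 𝒢.Gv v →ₜ* M) {e : 𝒢.graph.Edge} {b' : 𝒢.graph.Branch}
    {v' : 𝒢.graph.Vertex} (hb' : 𝒢.graph.abuts b' = some v') (he : 𝒢.graph.edgeOf b' = e) {P : M → Prop}
    (h : ∀ t' : 𝒢.Ge (𝒢.graph.edgeOf b'), P (χ v' (𝒢.brHom b' v' hb' t'))) (t : 𝒢.Ge e) :
    P ((he ▸ (χ v').comp (𝒢.brHom b' v' hb') : 𝒢.Ge e →ₜ* M) t) := by
  subst he
  exact h t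

omit [DiscreteTopology M] [Finite M] in
/-- Values of a transported homomorphism: every value of `f` is a value of `he ▸ f`. [cite: MochizukiSemiAnbd2006, Def 3.5(i) p.37] -/
theorem exists_transport (χ : ∀ v : 𝒢.graph.Vertex, 𝒢.Gv v →ₜ* M) {e : 𝒢.graph.Edge} {b' : 𝒢.graph.Branch}
    {v' : 𝒢.graph.Vertex} (hb' : 𝒢.graph.abuts b' = some v') (he : 𝒢.graph.edgeOf b' = e) {P : M → Prop}
    (h : ∃ t' : 𝒢.Ge (𝒢.graph.edgeOf b'), P (χ v' (𝒢.brHom b' v' hb' t'))) :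
    ∃ t : 𝒢.Ge e, P ((he ▸ (χ v').comp (𝒢.brHom b' v' hb') : 𝒢.Ge e →ₜ* M) t) := by
  subst he
  exact h

end TranslationCover

end Literature.IUT.HodgeTheaters
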